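import Summits.HodgeConjecture.HodgeConjecture.Theorems.MilnorKExponentialDefs
import Summits.HodgeConjecture.HodgeConjecture.Theorems.MilnorKExponentialSymbolClassesAlgebraicSymbolClassesHodgeType
import Summits.HodgeConjecture.HodgeConjecture.Theorems.MilnorKExponentialSymbolClassesAlgebraicNashSymbolConiveauOne
import Summits.HodgeConjecture.HodgeConjecture.Theorems.MilnorKExponentialSymbolClassesAlgebraicNashSymbolClassesAlgebraicHigh
import Literature.AlgebraicGeometry.HodgeTheory.SupportedHodgeClassesAlgebraic
import Literature.AlgebraicGeometry.HodgeTheory.GysinKernelProofs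
import Literature.AlgebraicGeometry.HodgeTheory.SaitoGrFDeRhamCurveNetHolds
import Literature.AlgebraicGeometry.HodgeTheory.HodgeRiemannPolarizabilityProofs
import Literature.AlgebraicGeometry.Resolution.ProjectiveResolutionProofs
import Literature.AlgebraicGeometry.HodgeTheory.ComplexOrientationFamily
import Literature.AlgebraicGeometry.HodgeTheory.LefschetzOneOneHolds

/-!
# Line `NashDescentSketch` for the crux `SymbolClassesAlgebraic` (GK_p) — lead's skeleton (v3, reshaped after wave 1)

Crux (route `MilnorKExponential`, item stmt-HodgeConjecture-17743): on a smooth projective complex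
`n`-fold every RATIONAL symbol class of weight `p = q + 1` lies in `algebraicClasses X (q + 1)`.

What wave 1 LANDED (all sorry-free, axioms standard):
* vocabulary `Theorems/MilnorKExponentialDefs.lean` (p148487): Nash units/cocycles/classes, named statements;
* stub (T) `stub_symbolClassesHodgeType : HodgeTypeNamed` — rational symbol classes are `(q+1,q+1)`
  (p152388 + p151170/p151359/p152061; it also closed the route's support item stmt-17746, p152905);
* (W₁) partial (p154170): weight 1, `n < 2(q+1)`, `n ≤ 3` unconditional; `…_low_weights_of_weightTwoBand`,
  `…_of_band` (W₁ ⇐ its band in die-off form);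
* (W_alg ≥ 3) partial (p154827): `n < q+1`, `n = q+1` (points), `n = q+2` (curve classes: hard Lefschetz
  + Lefschetz (1,1)), `n ≤ 3` unconditional; `…High_of_band` (stub ⇐ band `2 ≤ q`, `q + 3 ≤ n`).

Consequence recorded here (`gkNamed_outside_band`, PROVED): GK holds UNCONDITIONALLY for symbol
classes outside the band `1 ≤ q`, `q + 3 ≤ n` (so `n ≥ 4`): weight 1 (Lefschetz (1,1)), `dim ≤ 3`,
above the dimension, top degree, curve classes — no Nash input at all.

The OPEN stubs are therefore exactly the band, split as the line splits it:
* (A-band) `stub_nashDescentBand` — Nash descent for rational symbol classes of weight `q + 1`,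
  `1 ≤ q`, `q + 3 ≤ n` (held by the lead; crux-sized: `nashDescent_of_gk` in the Defs file);
* (W₁-band) `stub_nashWeightTwoBandDiesOffClosed` — on an `n`-fold, `n ≥ 4`, a rational NASH symbol
  class of weight 2 dies on the complement of a proper Zariski-closed subset (steps (G)+(W) of the card;
  = hypothesis of the landed `nashSymbolConiveauOne_low_weights_of_weightTwoBand`; first case `n = 4`);
* (W_alg-band) `stub_nashHighBandAlgebraic` — rational Nash symbol classes of weight `3 ≤ q+1 ≤ n-2`
  are algebraic (= hypothesis of the landed `nashSymbolClassesAlgebraicHigh_of_band`; first case `(5,3)`).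

Composition (`SymbolClassesAlgebraic_of`, proved): outside the band `gkNamed_outside_band`; inside,
(A-band) makes the class Nash; weight 2: (W₁-band) ⇒ coniveau one ⇒ algebraic by Voisin 2013 L2.1
(`supportedHodgeClass_algebraic_of_facts`, facts discharged) with (T); weight `≥ 3`: (W_alg-band).

Sorries: exactly the three `stub_*` theorems.
-/

noncomputable section

open scoped Manifold Topology
open CategoryTheory AlgebraicGeometry Filter

-- mandated namespace `Summit.HodgeConjecture.HodgeConjecture.…` (single-problem summit) trips dupNamespace
set_option linter.dupNamespace false

namespace Summit.HodgeConjecture.HodgeConjecture.Theorems.MilnorKExponentialNash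

open Literature.AlgebraicGeometry Literature.AlgebraicGeometry.HodgeTheory
  Literature.AlgebraicGeometry.Motives Literature.Geometry.Kaehler
  Literature.NumberTheory.Transcendental

/-! ### The open stubs (the ONLY sorries of this file): the band `1 ≤ q`, `q + 3 ≤ n` -/

/-- Stub (A-band): Nash descent in the band — every rational symbol class of weight `q + 1` with
`1 ≤ q`, `q + 3 ≤ n` on a smooth projective complex `n`-fold is a Nash symbol class. -/
theorem stub_nashDescentBand :
    ∀ ⦃n : ℕ⦄ ⦃X : SchemeOver ℂ⦄, IsSmoothProjective n X → ∀ (q : ℕ), 1 ≤ q → q + 3 ≤ n →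
      ∀ (c : complexBetti X (2 * (q + 1))), IsRationalClass c → IsSymbolClass n X q c →
        IsNashSymbolClass n X q c := by
  sorry

/-- Stub (W₁-band): on a smooth projective complex `n`-fold with `n ≥ 4`, every rational Nash symbol
class of weight `2` dies on `(X ∖ Z)(ℂ)` for some proper Zariski-closed `Z ⊊ X`. -/
theorem stub_nashWeightTwoBandDiesOffClosed :
    ∀ ⦃n : ℕ⦄ ⦃X : SchemeOver ℂ⦄, IsSmoothProjective n X → 4 ≤ n →
      ∀ (c : complexBetti X (2 * (1 + 1))), IsRationalClass c → IsNashSymbolClass n X 1 c →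
        ∃ Z : Set X.left, IsClosed Z ∧ Z ≠ Set.univ ∧
          complexBetti.restrictCompl X Z (2 * (1 + 1)) c = 0 := by
  sorry

/-- Stub (W_alg-band): rational Nash symbol classes of weight `q + 1` with `2 ≤ q`, `q + 3 ≤ n` are
algebraic. -/
theorem stub_nashHighBandAlgebraic :
    ∀ ⦃n : ℕ⦄ ⦃X : SchemeOver ℂ⦄, IsSmoothProjective n X → ∀ (q : ℕ), 2 ≤ q → q + 3 ≤ n →
      ∀ (c : complexBetti X (2 * (q + 1))), IsRationalClass c → IsNashSymbolClass n X q c →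
        c ∈ algebraicClasses X (q + 1) := by
  sorry

/-! ### GK outside the band — unconditional, no Nash input -/

/-- **GK holds unconditionally outside the band `1 ≤ q`, `q + 3 ≤ n`.** For a rational symbol class
`c` of weight `q + 1` on a smooth projective `n`-fold: weight `1` is Lefschetz `(1,1)`
(`lefschetzOneOne_rational_holds`) since `c` is a rational `(1,1)`-class (stub (T)); for `n ≤ q + 2`
the class is `0` above the dimension, a point class in the top degree, or a curve class
(`mem_algebraicClasses_above_dim/top_degree/curveClasses`, the last by hard Lefschetz + Lefschetz
`(1,1)` on the rational `(n-1,n-1)`-class given by (T)); for `n ≤ 3` it is the Hodge conjecture for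
curves, surfaces and threefolds (`hodgeClasses_algebraic_of_dim_le_three_holds`) applied to the
rational `(q+1,q+1)`-class given by (T). -/
theorem gkNamed_outside_band ⦃n : ℕ⦄ ⦃X : SchemeOver ℂ⦄ (hX : IsSmoothProjective n X) (q : ℕ)
    (hband : q = 0 ∨ n ≤ q + 2 ∨ n ≤ 3) (c : complexBetti X (2 * (q + 1))) (hc : IsRationalClass c)
    (hs : IsSymbolClass n X q c) : c ∈ algebraicClasses X (q + 1) := by
  have hT : IsOfHodgeType n X (2 * (q + 1)) (q + 1) (q + 1) c := stub_symbolClassesHodgeType hX q c hc hs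
  rcases hband with rfl | hle | hle3
  · exact lefschetzOneOne_rational_holds hX c hc hT
  · rcases Nat.lt_or_ge n (q + 1) with hlt | hge
    · exact mem_algebraicClasses_above_dim hX hlt c
    · rcases eq_or_lt_of_le hge with heq | hgt
      · exact mem_algebraicClasses_top_degree hX heq c
      · exact mem_algebraicClasses_curveClasses hX (by omega) c hc hT
  · exact hodgeClasses_algebraic_of_dim_le_three_holds hle3 hX (q + 1) c hc hT

/-! ### Composition (proved) -/

/-- **GK from the three band stubs.** Outside the band: `gkNamed_outside_band`. Inside (`1 ≤ q`,
`q + 3 ≤ n`): the class is a Nash symbol class by (A-band); in weight `2` it dies off a proper closed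
subset by (W₁-band), hence has coniveau `≥ 1` (`nashSymbolConiveauOne_low_weights_of_weightTwoBand`)
and is algebraic by Voisin 2013 Lemma 2.1 (`supportedHodgeClass_algebraic_of_facts`, all facts
discharged in the tree) applied to the rational `(2,2)`-class given by (T); in weight `≥ 3` it is
algebraic by (W_alg-band). -/
theorem gkNamed_of_bands
    (hA : ∀ ⦃n : ℕ⦄ ⦃X : SchemeOver ℂ⦄, IsSmoothProjective n X → ∀ (q : ℕ), 1 ≤ q → q + 3 ≤ n →
      ∀ (c : complexBetti X (2 * (q + 1))), IsRationalClass c → IsSymbolClass n X q c →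
        IsNashSymbolClass n X q c)
    (h2 : ∀ ⦃n : ℕ⦄ ⦃X : SchemeOver ℂ⦄, IsSmoothProjective n X → 4 ≤ n →
      ∀ (c : complexBetti X (2 * (1 + 1))), IsRationalClass c → IsNashSymbolClass n X 1 c →
        ∃ Z : Set X.left, IsClosed Z ∧ Z ≠ Set.univ ∧
          complexBetti.restrictCompl X Z (2 * (1 + 1)) c = 0)
    (h3 : ∀ ⦃n : ℕ⦄ ⦃X : SchemeOver ℂ⦄, IsSmoothProjective n X → ∀ (q : ℕ), 2 ≤ q → q + 3 ≤ n →
      ∀ (c : complexBetti X (2 * (q + 1))), IsRationalClass c → IsNashSymbolClass n X q c →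
        c ∈ algebraicClasses X (q + 1)) :
    GKNamed := by
  intro n X hX q c hc hs
  by_cases hband : q = 0 ∨ n ≤ q + 2 ∨ n ≤ 3
  · exact gkNamed_outside_band hX q hband c hc hs
  · simp only [not_or, not_le] at hband
    obtain ⟨hq0, hqn, hn3⟩ := hband
    have hN : IsNashSymbolClass n X q c := hA hX q (by omega) (by omega) c hc hs
    rcases q with _ | _ | q
    · exact absurd rfl hq0
    · -- weight 2: die-off ⇒ coniveau one ⇒ algebraic (Voisin 2013 L2.1 + (T))
      have h1 : c ∈ supportedClasses X (2 * (1 + 1)) 1 :=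
        nashSymbolConiveauOne_low_weights_of_weightTwoBand h2 hX 1 le_rfl c hc hN
      exact supportedHodgeClass_algebraic_of_facts
        Deligne1974_ker_restrictCompl_eq_iSup_range_complexGysin_holds
        Voisin2025_hodgeClass_lift_complexGysin_holds
        (Literature.AlgebraicTopology.SingularHomology.gysinMap_restrictCompl_eq_zero_of_field ℂ)
        Resolution.Hironaka1964_projective_holds lefschetzOneOne_rational_holds complexOrientationFamily
        (OrientationFamily.hasPoincareDuality _) hX 1 c h1 hc
        (stub_symbolClassesHodgeType hX 1 c hc hs)
    · -- weight ≥ 3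
      exact h3 hX (q + 2) (by omega) (by omega) c hc hN

/-- **The line closes the crux BY NAME modulo its three band stubs.** -/
theorem SymbolClassesAlgebraic_of : Theses.MilnorKExponential.SymbolClassesAlgebraic :=
  route_of_gkNamed <|
    gkNamed_of_bands stub_nashDescentBand stub_nashWeightTwoBandDiesOffClosed stub_nashHighBandAlgebraic

end Summit.HodgeConjecture.HodgeConjecture.Theorems.MilnorKExponentialNash

end
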